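import Mathlib
import Literature.MathematicalPhysics.QuantumLattice.GrassmannEffectiveActionBlocks
import Literature.MathematicalPhysics.QuantumLattice.HubbardDiagonalQuadraticResummation
import HarnessLib

/-!
# The effective action of a DIAGONAL quadratic form under a NORMAL covariance — closed form

Topic `MathematicalPhysics/QuantumLattice`; continuation of `HubbardDiagonalQuadraticResummation` (the two-leg resummation
`effAction C (V + Q) = effAction C Q + S_m(effAction C̃ V)` for the Hubbard normal covariance `C = normalCovariance p` and a diagonal quadratic
`Q = Σ_{kσ} κ(k,σ) ψ̂⁺_{kσ}ψ̂⁻_{kσ}`) and of `GrassmannEffectiveActionBlocks` (decoupled blocks: `effAction_add_of_blockDiag`).  Here the remaining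
Gaussian term is computed in closed form:

* `effAction_normalCovariance_smul_genPair` — ONE mode: `effAction (normalCovariance p) (c·ψ⁺_{kσ}ψ⁻_{kσ}) = (c/(1 + p(kσ)c))·ψ⁺_{kσ}ψ⁻_{kσ}` and
  `Z = 1 + p(kσ)c` (a two-dimensional Grassmann integral: `(ψ⁺ψ⁻)² = 0`, `e^{Δ}(ψ⁺ψ⁻) = ψ⁺ψ⁻ − p`, `log(1+x) = x` for `x² = 0`);
* **`effAction_normalCovariance_diagQuadratic`** — ALL modes, by independence of the modes under a normal covariance
  (`effAction_add_of_blockDiag`, block = the two charges of one momentum–spin label):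
  **`effAction (normalCovariance p) (Σ_{kσ} κ ψ⁺ψ⁻) = Σ_{kσ} (κ/(1+pκ)) ψ⁺ψ⁻`**, `Z = Π_{kσ} (1 + pκ)` — the resummed («dressed») two-leg vertex,
  in particular it has NO kernels of degree `≥ 3` and Gaussian smearing only adds a constant to it (BGM 2006 (2.20)/(2.23): the quadratic part
  of the effective potential renormalises the propagator and nothing else).

Salmhofer 1999, §4.2 (Gaussian Grassmann integrals; (4.16)–(4.20) the quadratic case) and Def. 2.19; Benfatto–Giuliani–Mastropietro 2006, §2.3.
Everything is proved; no definition, no named fact.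
-/

noncomputable section

namespace Literature.MathematicalPhysics.QuantumLattice

open GrassmannAlgebra Finset Matrix

variable {L M : ℕ} [NeZero L]

omit [NeZero L] in
/-- `(ψ(X)ψ(Y))² = 0` (generators anticommute and square to zero). [cite: Berezin1966, Ch. I §3 (3.1)] -/
theorem gen_mul_gen_mul_self (X Y : HubbardFieldIdx L M) : gen ℂ X * gen ℂ Y * (gen ℂ X * gen ℂ Y) = 0 := by
  have hYX : gen ℂ Y * gen ℂ X = -(gen ℂ X * gen ℂ Y) := gen_mul_gen ℂ Y X
  calc gen ℂ X * gen ℂ Y * (gen ℂ X * gen ℂ Y) = gen ℂ X * (gen ℂ Y * gen ℂ X) * gen ℂ Y := by simp only [mul_assoc]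
    _ = 0 := by rw [hYX, mul_neg, neg_mul, ← mul_assoc, gen_mul_self, zero_mul, zero_mul, neg_zero]

/-- **One mode.**  For the normal covariance with symbol `p` and one momentum–spin label `kσ` with `1 + p(kσ)c ≠ 0`:
`effAction (normalCovariance p) (c·ψ⁺_{kσ}ψ⁻_{kσ}) = (c/(1+p(kσ)c))·ψ⁺_{kσ}ψ⁻_{kσ}` and `Z = 1 + p(kσ)c`. [cite: Salmhofer1999, §4.2 (4.16)-(4.20)] -/
theorem effAction_normalCovariance_smul_genPair (p : FreqMomentum L M × Fin 2 → ℂ) (ks : FreqMomentum L M × Fin 2) (c : ℂ)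
    (hden : 1 + p ks * c ≠ 0) :
    effAction ℂ (normalCovariance L M p) (c • (gen ℂ ((ks, 0) : HubbardFieldIdx L M) * gen ℂ ((ks, 1) : HubbardFieldIdx L M))) =
        (c / (1 + p ks * c)) • (gen ℂ ((ks, 0) : HubbardFieldIdx L M) * gen ℂ ((ks, 1) : HubbardFieldIdx L M)) ∧
      effPartitionFn ℂ (normalCovariance L M p) (c • (gen ℂ ((ks, 0) : HubbardFieldIdx L M) * gen ℂ ((ks, 1) : HubbardFieldIdx L M))) =
        1 + p ks * c := by
  set n : HubbardGrassmann L M := gen ℂ ((ks, 0) : HubbardFieldIdx L M) * gen ℂ ((ks, 1) : HubbardFieldIdx L M) with hn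
  have hn2 : n * n = 0 := gen_mul_gen_mul_self _ _
  have hsq : ∀ a : ℂ, (a • n) ^ 2 = 0 := fun a => by rw [pow_two, smul_mul_smul_comm, hn2, smul_zero]
  -- `e^{-c n} = 1 - c n`
  have hexp : grassmannExp (-(c • n)) = 1 - c • n := by
    rw [grassmannExp, ← neg_smul, IsNilpotent.exp_eq_sum (hsq (-c))]
    simp [Finset.sum_range_succ, sub_eq_add_neg]
  -- `e^{Δ} n = n - p`
  have hconv : gaussConv ℂ (normalCovariance L M p) n = n + algebraMap ℂ (HubbardGrassmann L M) (-p ks) := by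
    rw [hn, gaussConv_gen_mul_gen]
    congr 2
    rw [normalCovariance_apply, normalCovariance_apply, Rat.smul_one_eq_cast]
    simp
    ring
  have hB : effBoltzmann ℂ (normalCovariance L M p) (c • n) = algebraMap ℂ (HubbardGrassmann L M) (1 + p ks * c) - c • n := by
    rw [effBoltzmann_def, hexp, map_sub, gaussConv_one, map_smul, hconv, smul_add, map_add, map_one, Algebra.smul_def, Algebra.smul_def,
      ← map_mul, mul_neg, mul_comm c (p ks), map_neg]
    abel
  have hZ : effPartitionFn ℂ (normalCovariance L M p) (c • n) = 1 + p ks * c := by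
    rw [effPartitionFn_eq_gaussExpect, gaussExpect_apply, ← effBoltzmann_def, hB, map_sub, map_smul, hn, map_mul, constPart_gen, zero_mul,
      smul_zero, sub_zero, Algebra.algebraMap_eq_smul_one, map_smul, map_one, smul_eq_mul, mul_one]
  refine ⟨?_, hZ⟩
  have hx : Ring.inverse (effPartitionFn ℂ (normalCovariance L M p) (c • n)) • effBoltzmann ℂ (normalCovariance L M p) (c • n) - 1 =
      -((c / (1 + p ks * c)) • n) := by
    rw [hZ, hB, Ring.inverse_eq_inv', smul_sub, Algebra.smul_def, ← map_mul, inv_mul_cancel₀ hden, map_one, smul_smul, div_eq_inv_mul]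
    abel
  rw [effAction_def, hx, grassmannLog1p_eq_sum ℂ (m := 2) (by rw [neg_pow_two]; exact hsq _)]
  simp [Finset.sum_range_succ]

/-- **All modes — the effective action of a diagonal quadratic form under a normal covariance is the RESUMMED diagonal quadratic form**:
with `1 + p(kσ)κ(kσ) ≠ 0` for every label, `effAction (normalCovariance p) (Σ_{kσ∈T} κ ψ⁺ψ⁻) = Σ_{kσ∈T} (κ/(1+pκ)) ψ⁺ψ⁻` and
`Z = Π_{kσ∈T} (1 + pκ)` (independent modes: `effAction_add_of_blockDiag`). [cite: Salmhofer1999, Def. 2.19 (2.102)-(2.106)] -/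
theorem effAction_normalCovariance_diagQuadratic_finset (p κ : FreqMomentum L M × Fin 2 → ℂ) (hden : ∀ ks, 1 + p ks * κ ks ≠ 0)
    (T : Finset (FreqMomentum L M × Fin 2)) :
    effAction ℂ (normalCovariance L M p)
          (∑ ks ∈ T, κ ks • (gen ℂ ((ks, 0) : HubbardFieldIdx L M) * gen ℂ ((ks, 1) : HubbardFieldIdx L M))) =
        ∑ ks ∈ T, (κ ks / (1 + p ks * κ ks)) • (gen ℂ ((ks, 0) : HubbardFieldIdx L M) * gen ℂ ((ks, 1) : HubbardFieldIdx L M)) ∧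
      effPartitionFn ℂ (normalCovariance L M p)
          (∑ ks ∈ T, κ ks • (gen ℂ ((ks, 0) : HubbardFieldIdx L M) * gen ℂ ((ks, 1) : HubbardFieldIdx L M))) =
        ∏ ks ∈ T, (1 + p ks * κ ks) := by
  classical
  induction T using Finset.induction_on with
  | empty =>
    refine ⟨by rw [sum_empty, sum_empty, effAction_zero_interaction], ?_⟩
    rw [sum_empty, prod_empty, effPartitionFn_eq_gaussExpect, neg_zero, grassmannExp, IsNilpotent.exp_zero, gaussExpect_one]
  | insert ks T hks ih =>
    -- block of the new mode: its two charges
    set S : Set (HubbardFieldIdx L M) := {X | X.1 = ks} with hS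
    have hC₁ : ∀ X Y : HubbardFieldIdx L M, X ∈ S → Y ∉ S → normalCovariance L M p X Y = 0 := by
      intro X Y hX hY
      rw [normalCovariance_apply, if_neg]
      intro h; exact hY (by rw [hS, Set.mem_setOf_eq, ← h]; exact hX)
    have hC₂ : ∀ X Y : HubbardFieldIdx L M, X ∉ S → Y ∈ S → normalCovariance L M p X Y = 0 := by
      intro X Y hX hY
      rw [normalCovariance_apply, if_neg]
      intro h; exact hX (by rw [hS, Set.mem_setOf_eq, h]; exact hY)
    set V₁ : HubbardGrassmann L M := κ ks • (gen ℂ ((ks, 0) : HubbardFieldIdx L M) * gen ℂ ((ks, 1) : HubbardFieldIdx L M)) with hV₁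
    set V₂ : HubbardGrassmann L M :=
      ∑ ks' ∈ T, κ ks' • (gen ℂ ((ks', 0) : HubbardFieldIdx L M) * gen ℂ ((ks', 1) : HubbardFieldIdx L M)) with hV₂
    have hV₁S : V₁ ∈ fieldSubalgebra ℂ S :=
      Subalgebra.smul_mem _ (Subalgebra.mul_mem _ (gen_mem_fieldSubalgebra ℂ (by simp [hS])) (gen_mem_fieldSubalgebra ℂ (by simp [hS]))) _
    have hV₁e : V₁ ∈ evenOdd ℂ 0 := by
      have h := SetLike.mul_mem_graded (gen_mem_evenOdd_one (R := ℂ) ((ks, 0) : HubbardFieldIdx L M))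
        (gen_mem_evenOdd_one (R := ℂ) ((ks, 1) : HubbardFieldIdx L M))
      rw [show (1 : ZMod 2) + 1 = 0 from by decide] at h
      exact Submodule.smul_mem _ _ h
    have hV₁c : constPart ℂ V₁ = 0 := by rw [hV₁, map_smul, map_mul, constPart_gen, zero_mul, smul_zero]
    have hV₂S : V₂ ∈ fieldSubalgebra ℂ Sᶜ := by
      refine Subalgebra.sum_mem _ fun ks' hks' => Subalgebra.smul_mem _ (Subalgebra.mul_mem _ ?_ ?_) _
      · exact gen_mem_fieldSubalgebra ℂ (by simp [hS]; rintro rfl; exact hks hks')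
      · exact gen_mem_fieldSubalgebra ℂ (by simp [hS]; rintro rfl; exact hks hks')
    have hV₂c : constPart ℂ V₂ = 0 := by
      rw [hV₂, map_sum]
      exact sum_eq_zero fun ks' _ => by rw [map_smul, map_mul, constPart_gen, zero_mul, smul_zero]
    have h1 := effAction_normalCovariance_smul_genPair p ks (κ ks) (hden ks)
    have hZ₁ : IsUnit (effPartitionFn ℂ (normalCovariance L M p) V₁) := by rw [hV₁, h1.2]; exact isUnit_iff_ne_zero.mpr (hden ks)
    have hZ₂ : IsUnit (effPartitionFn ℂ (normalCovariance L M p) V₂) := by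
      rw [hV₂, ih.2]
      exact isUnit_iff_ne_zero.mpr (prod_ne_zero_iff.mpr fun ks' _ => hden ks')
    rw [sum_insert hks, sum_insert hks, prod_insert hks]
    refine ⟨?_, ?_⟩
    · rw [effAction_add_of_blockDiag ℂ (normalCovariance L M p) hC₁ hC₂ hV₁S hV₁e hV₁c hV₂S hV₂c hZ₁ hZ₂, h1.1, ih.1]
    · rw [effPartitionFn_add_of_blockDiag ℂ (normalCovariance L M p) hC₁ hC₂ hV₁S hV₁e hV₁c hV₂S hV₂c, h1.2, ih.2]

/-- **`effAction_normalCovariance_diagQuadratic`** (all labels): `effAction (normalCovariance p) (Σ_{kσ} κ ψ⁺ψ⁻) = Σ_{kσ} (κ/(1+pκ)) ψ⁺ψ⁻` — the Gaussian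
integral of the two-leg part is the DRESSED two-leg part (symbol `κ/(1+pκ)`), a quadratic form: no kernels of degree `≥ 3`. [cite: BenfattoGiulianiMastropietro2006, §2.3 (2.20)-(2.23)] -/
theorem effAction_normalCovariance_diagQuadratic [NeZero M] (p κ : FreqMomentum L M × Fin 2 → ℂ) (hden : ∀ ks, 1 + p ks * κ ks ≠ 0) :
    effAction ℂ (normalCovariance L M p)
        (∑ ks : FreqMomentum L M × Fin 2, κ ks • (gen ℂ ((ks, 0) : HubbardFieldIdx L M) * gen ℂ ((ks, 1) : HubbardFieldIdx L M))) =
      ∑ ks : FreqMomentum L M × Fin 2,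
        (κ ks / (1 + p ks * κ ks)) • (gen ℂ ((ks, 0) : HubbardFieldIdx L M) * gen ℂ ((ks, 1) : HubbardFieldIdx L M)) :=
  (effAction_normalCovariance_diagQuadratic_finset p κ hden Finset.univ).1

/-- … and its partition function: `Z = Π_{kσ} (1 + p(kσ)κ(kσ))` (nonzero under the resummation condition). [cite: Salmhofer1999, §4.2 (4.16)-(4.20)] -/
theorem effPartitionFn_normalCovariance_diagQuadratic [NeZero M] (p κ : FreqMomentum L M × Fin 2 → ℂ) (hden : ∀ ks, 1 + p ks * κ ks ≠ 0) :
    effPartitionFn ℂ (normalCovariance L M p)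
        (∑ ks : FreqMomentum L M × Fin 2, κ ks • (gen ℂ ((ks, 0) : HubbardFieldIdx L M) * gen ℂ ((ks, 1) : HubbardFieldIdx L M))) =
      ∏ ks : FreqMomentum L M × Fin 2, (1 + p ks * κ ks) :=
  (effAction_normalCovariance_diagQuadratic_finset p κ hden Finset.univ).2

end Literature.MathematicalPhysics.QuantumLattice

end
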